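import Literature.NumberTheory.Sieve.GoldbachLinnikParseval
import Literature.NumberTheory.Sieve.VinogradovExpSumTools
import Literature.NumberTheory.LFunctions.ChebyshevPsiLogPowerError
import HarnessLib

/-!
# Goldbach–Linnik numbers: the mass of `|S(β)|²` near `β = 0` (for Pintz–Ruzsa I, (8.20))

Topic `Literature/NumberTheory/Sieve`; support file for the named fact
`Literature.NumberTheory.Sieve.goldbach_linnik` (parity.S36). Here `S(β) = ∑_{p ≤ N, p odd} e(pβ)`
(`GoldbachLinnik.primeSum`).

**Main result** (`setIntegral_normSq_primeSum_central_ge`): for every `ε > 0` and all large `N`,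

  `∫_{|β| ≤ (log N)³/N} |S(β)|² dβ ≥ (1 - ε) N/log² N`.

This is the `q = 1` ("central") case of the major-arc mass evaluation
`∫_𝔐 |S|² ∼ (N/log² N) ∑_{q ≤ P} μ²(q)/φ(q)` behind Pintz–Ruzsa I (8.20)–(8.21)
(`R₂(0) = π(N) - ∫_𝔐 |S|² ∼ (1 - log P/log N) N/log N`); the sequel
`GoldbachLinnikMajorArcMass.lean` transports it to all square-free `q ≤ P` by positivity.
Proof (classical, e.g. Vaughan, *The Hardy–Littlewood Method*, §3.1–3.2 for the model `T`):
with `T(β) = ∑_{3 ≤ n ≤ N} e(nβ)/log n`,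

* `∫₀¹ |T|² = ∑_{3 ≤ n ≤ N} 1/log² n ≥ (N - 2)/log² N` (Parseval, `integral_norm_sq_weightedExpSum`);
* `|T(β)| ≤ 1/(2 log 3 · ‖β‖)` (Abel summation with the decreasing weights `1/log n`,
  `norm_sum_range_smul_le_of_antitone`, and the geometric sum), so
  `∫_{(log N)³/N ≤ |β| ≤ 1/2} |T|² ≤ N/(2 log² 3 · log³ N)`;
* `|S(β) - T(β)| ≤ (1 + 2π|β|N) · max_{x ≤ N} |π₂(x) - ∑_{3 ≤ n ≤ x} 1/log n|` (Abel summation,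
  `norm_sum_range_fourierChar_mul_le`) and the prime number theorem with error term
  `ψ(x) - x = O(x/log⁷ x)` (tree: `LFunctions.PsiLogPower.chebyshevPsi_sub_self_isBigO_div_logPow`)
  give `∫_{|β| ≤ (log N)³/N} |S - T|² = O(N/log⁵ N)`;
* `|S|² ≥ |T|²/(1 + η) - |S - T|²/η`.

Everything here is PROVED; no definitions and no named facts are introduced.

## References

* J. Pintz, I. Z. Ruzsa, *On Linnik's approximation to Goldbach's problem, I*, Acta Arith. 109
  (2003) 169–194, §8 (8.20)–(8.21). [PintzRuzsa2003]
* R. C. Vaughan, *The Hardy–Littlewood Method*, 2nd ed. (1997), §3.1–§3.2 (the major-arc model),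
  Lemma 2.? (Abel summation). [VaughanHL1997]
-/

noncomputable section

open scoped FourierTransform Topology Real

open Finset Filter MeasureTheory

namespace Literature.NumberTheory.Sieve

namespace GoldbachLinnik

open Vinogradov (distInt distInt_nonneg norm_sum_Ioc_fourierChar_mul_distInt_le)

/-! ### Two Abel-summation inequalities -/

/-- **Abel's inequality, antitone weights**: if `f₀ ≥ f₁ ≥ ⋯ ≥ f_{n-1} ≥ 0` and all partial sums
`‖∑_{i<k} g_i‖ ≤ B` (`k ≤ n`), then `‖∑_{i<n} f_i g_i‖ ≤ f₀ B`. [cite: VaughanHL1997, §2 (Abel summation)] -/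
theorem norm_sum_range_smul_le_of_antitone {V : Type*} [SeminormedAddCommGroup V] [NormedSpace ℝ V]
    {f : ℕ → ℝ} {g : ℕ → V} {n : ℕ} (hn : 0 < n) {B : ℝ}
    (hf : ∀ i, i + 1 < n → f (i + 1) ≤ f i) (hfn : 0 ≤ f (n - 1))
    (hB : ∀ k, k ≤ n → ‖∑ i ∈ range k, g i‖ ≤ B) :
    ‖∑ i ∈ range n, f i • g i‖ ≤ f 0 * B := by
  have hB0 : 0 ≤ B := (norm_nonneg _).trans (hB 0 (Nat.zero_le _))
  rw [Finset.sum_range_by_parts]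
  have h1 : ‖f (n - 1) • ∑ i ∈ range n, g i‖ ≤ f (n - 1) * B := by
    rw [norm_smul, Real.norm_of_nonneg hfn]
    exact mul_le_mul_of_nonneg_left (hB n le_rfl) hfn
  have h2 : ‖∑ i ∈ range (n - 1), (f (i + 1) - f i) • ∑ j ∈ range (i + 1), g j‖ ≤
      (f 0 - f (n - 1)) * B := by
    refine (norm_sum_le _ _).trans ?_
    calc ∑ i ∈ range (n - 1), ‖(f (i + 1) - f i) • ∑ j ∈ range (i + 1), g j‖
        ≤ ∑ i ∈ range (n - 1), (f i - f (i + 1)) * B := by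
          refine Finset.sum_le_sum fun i hi => ?_
          rw [mem_range] at hi
          have hfi : f (i + 1) ≤ f i := hf i (by omega)
          rw [norm_smul, Real.norm_eq_abs, abs_sub_comm, abs_of_nonneg (by linarith)]
          exact mul_le_mul_of_nonneg_left (hB (i + 1) (by omega)) (by linarith)
      _ = (f 0 - f (n - 1)) * B := by rw [← Finset.sum_mul, Finset.sum_range_sub']
  calc ‖f (n - 1) • ∑ i ∈ range n, g i -
        ∑ i ∈ range (n - 1), (f (i + 1) - f i) • ∑ j ∈ range (i + 1), g j‖
      ≤ f (n - 1) * B + (f 0 - f (n - 1)) * B := (norm_sub_le _ _).trans (add_le_add h1 h2)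
    _ = f 0 * B := by ring

/-- `|e((i+1)β) - e(iβ)| ≤ 2π|β|`. [folklore] -/
theorem norm_fourierChar_succ_sub_le (i : ℕ) (β : ℝ) :
    ‖(𝐞 (((i + 1 : ℕ) : ℝ) * β) : ℂ) - (𝐞 ((i : ℝ) * β) : ℂ)‖ ≤ 2 * π * |β| := by
  have h : (𝐞 (((i + 1 : ℕ) : ℝ) * β) : ℂ) = (𝐞 ((i : ℝ) * β) : ℂ) * (𝐞 β : ℂ) := by
    rw [← fourierChar_add_coe]; congr 2; push_cast; ring
  rw [h, ← mul_sub_one, norm_mul, Circle.norm_coe, one_mul, Vinogradov.norm_fourierChar_sub_one]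
  have := Real.abs_sin_le_abs (x := π * β)
  rw [abs_mul, abs_of_pos Real.pi_pos] at this
  linarith

/-- **Abel's inequality, oscillating weights**: if all partial sums `|∑_{i<k} c_i| ≤ E` (`k ≤ n`),
then `‖∑_{i<n} c_i e(iβ)‖ ≤ (1 + 2π|β| n) E`. [cite: VaughanHL1997, §2 (Abel summation)] -/
theorem norm_sum_range_fourierChar_mul_le {c : ℕ → ℝ} {n : ℕ} (β : ℝ) {E : ℝ}
    (hE : ∀ k, k ≤ n → |∑ i ∈ range k, c i| ≤ E) :
    ‖∑ i ∈ range n, (c i : ℂ) * (𝐞 ((i : ℝ) * β) : ℂ)‖ ≤ (1 + 2 * π * |β| * n) * E := by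
  have hE0 : 0 ≤ E := (abs_nonneg _).trans (hE 0 (Nat.zero_le _))
  rcases Nat.eq_zero_or_pos n with rfl | hn
  · simp; positivity
  have hG : ∀ k, k ≤ n → ‖∑ i ∈ range k, (c i : ℂ)‖ ≤ E := by
    intro k hk
    rw [← Complex.ofReal_sum, Complex.norm_real, Real.norm_eq_abs]
    exact hE k hk
  have hsw : ∑ i ∈ range n, (c i : ℂ) * (𝐞 ((i : ℝ) * β) : ℂ) =
      ∑ i ∈ range n, (𝐞 ((i : ℝ) * β) : ℂ) • (c i : ℂ) := by
    refine Finset.sum_congr rfl fun i _ => ?_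
    rw [smul_eq_mul, mul_comm]
  rw [hsw, Finset.sum_range_by_parts]
  have h1 : ‖(𝐞 (((n - 1 : ℕ) : ℝ) * β) : ℂ) • ∑ i ∈ range n, (c i : ℂ)‖ ≤ E := by
    rw [norm_smul, Circle.norm_coe, one_mul]; exact hG n le_rfl
  have h2 : ‖∑ i ∈ range (n - 1), ((𝐞 (((i + 1 : ℕ) : ℝ) * β) : ℂ) - (𝐞 ((i : ℝ) * β) : ℂ)) •
      ∑ j ∈ range (i + 1), (c j : ℂ)‖ ≤ (n - 1 : ℕ) * (2 * π * |β| * E) := by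
    refine (norm_sum_le _ _).trans ?_
    calc ∑ i ∈ range (n - 1), ‖((𝐞 (((i + 1 : ℕ) : ℝ) * β) : ℂ) - (𝐞 ((i : ℝ) * β) : ℂ)) •
          ∑ j ∈ range (i + 1), (c j : ℂ)‖
        ≤ ∑ _i ∈ range (n - 1), 2 * π * |β| * E := by
          refine Finset.sum_le_sum fun i hi => ?_
          rw [mem_range] at hi
          rw [norm_smul]
          exact mul_le_mul (norm_fourierChar_succ_sub_le i β) (hG (i + 1) (by omega))
            (norm_nonneg _) (by positivity)
      _ = (n - 1 : ℕ) * (2 * π * |β| * E) := by rw [Finset.sum_const, Finset.card_range, nsmul_eq_mul]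
  have hn1 : ((n - 1 : ℕ) : ℝ) ≤ n := by exact_mod_cast Nat.sub_le n 1
  calc ‖(𝐞 (((n - 1 : ℕ) : ℝ) * β) : ℂ) • ∑ i ∈ range n, (c i : ℂ) -
        ∑ i ∈ range (n - 1), ((𝐞 (((i + 1 : ℕ) : ℝ) * β) : ℂ) - (𝐞 ((i : ℝ) * β) : ℂ)) •
          ∑ j ∈ range (i + 1), (c j : ℂ)‖
      ≤ E + (n - 1 : ℕ) * (2 * π * |β| * E) := (norm_sub_le _ _).trans (add_le_add h1 h2)
    _ ≤ E + n * (2 * π * |β| * E) := by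
        have : 0 ≤ 2 * π * |β| * E := by positivity
        nlinarith
    _ = (1 + 2 * π * |β| * n) * E := by ring

/-! ### Parseval for weighted exponential sums -/

/-- `|∑_n w_n e(nα)|² = ∑_{n,m} w_n w_m e((n - m)α)` for real weights. [folklore] -/
theorem norm_sq_weightedExpSum_eq (s : Finset ℕ) (w : ℕ → ℝ) (α : ℝ) :
    ((‖∑ n ∈ s, ((w n : ℝ) : ℂ) * (𝐞 ((n : ℝ) * α) : ℂ)‖ ^ 2 : ℝ) : ℂ) =
      ∑ n ∈ s, ∑ m ∈ s, ((w n * w m : ℝ) : ℂ) * (𝐞 ((((n : ℤ) - m : ℤ) : ℝ) * α) : ℂ) := by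
  rw [← Complex.normSq_eq_norm_sq, ← Complex.mul_conj, map_sum, Finset.sum_mul_sum]
  refine Finset.sum_congr rfl fun n _ => Finset.sum_congr rfl fun m _ => ?_
  rw [map_mul (starRingEnd ℂ), Complex.conj_ofReal, ← Circle.coe_inv_eq_conj,
    ← AddChar.map_neg_eq_inv]
  have h : (𝐞 ((n : ℝ) * α) : ℂ) * (𝐞 (-((m : ℝ) * α)) : ℂ) =
      (𝐞 ((((n : ℤ) - m : ℤ) : ℝ) * α) : ℂ) := by
    rw [← Circle.coe_mul, ← AddChar.map_add_eq_mul]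
    congr 2
    push_cast
    ring
  push_cast at h ⊢
  rw [← h]
  ring

/-- **Parseval**: `∫₀¹ |∑_{n ∈ s} w_n e(nα)|² dα = ∑_{n ∈ s} w_n²` for real weights `w` and a finite
set `s ⊆ ℕ`. [cite: VaughanHL1997, §1.2 eq. (1.4)] -/
theorem integral_norm_sq_weightedExpSum (s : Finset ℕ) (w : ℕ → ℝ) :
    ∫ α in (0 : ℝ)..1, ‖∑ n ∈ s, ((w n : ℝ) : ℂ) * (𝐞 ((n : ℝ) * α) : ℂ)‖ ^ 2 =
      ∑ n ∈ s, w n ^ 2 := by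
  apply Complex.ofReal_injective
  rw [← intervalIntegral.integral_ofReal]
  simp_rw [norm_sq_weightedExpSum_eq]
  have hcont : ∀ (c : ℝ) (k : ℤ), Continuous fun α : ℝ => (c : ℂ) * (𝐞 ((k : ℝ) * α) : ℂ) :=
    fun c k => continuous_const.mul (continuous_subtype_val.comp
      (Real.continuous_fourierChar.comp (continuous_const.mul continuous_id)))
  have horth : ∀ n : ℤ, ∫ α in (0 : ℝ)..1, (𝐞 (n * α) : ℂ) = if n = 0 then 1 else 0 :=
    integral_fourierChar_intCast_holds
  rw [intervalIntegral.integral_finsetSum fun p _ =>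
    (continuous_finsetSum _ fun q _ => hcont _ _).intervalIntegrable _ _]
  simp_rw [intervalIntegral.integral_finsetSum fun q _ => (hcont _ _).intervalIntegrable _ _,
    intervalIntegral.integral_const_mul, horth, sub_eq_zero, Nat.cast_inj]
  push_cast
  refine Finset.sum_congr rfl fun n hn => ?_
  rw [Finset.sum_congr rfl fun x _ => by rw [mul_ite, mul_one, mul_zero], Finset.sum_ite_eq,
    if_pos hn, sq]

/-! ### The prime number theorem with error term, for `π₂(x) - ∑ 1/log n` -/

/-- The coefficients `c_i = 1_{odd prime}(i) - 1/log i` (`i ≥ 3`), `0` (`i < 3`), so that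
`S(β) - T(β) = ∑_{i ≤ N} c_i e(iβ)`. (Local abbreviation, unfolded in all statements.) [folklore] -/
theorem primeCountErrCoeff_eq (i : ℕ) :
    (if 3 ≤ i then ((if i.Prime then (1 : ℝ) else 0) - 1 / Real.log i) else 0) =
      (1 / Real.log ((max i 3 : ℕ) : ℝ)) *
        (if 3 ≤ i then ((if i.Prime then Real.log i else 0) - 1) else 0) := by
  split_ifs with h3 hp
  · rw [max_eq_left h3]
    have : Real.log i ≠ 0 := (Real.log_pos (by exact_mod_cast (show 1 < i by omega))).ne'
    field_simp
  · rw [max_eq_left h3]; ring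
  · ring

/-- Partial sums of `1_{prime}(i) log i - 1` over `3 ≤ i < k`:  `θ(k-1) - log 2 - (k - 3)` for
`k ≥ 3`; in absolute value at most `|θ(k-1) - (k-1)| + 2`. [folklore] -/
theorem abs_sum_range_thetaCoeff_le (k : ℕ) :
    |∑ i ∈ range k, (if 3 ≤ i then ((if i.Prime then Real.log i else 0) - 1) else 0)| ≤
      |Chebyshev.theta ((k - 1 : ℕ) : ℝ) - ((k - 1 : ℕ) : ℝ)| + 2 := by
  rcases lt_or_ge k 3 with hk | hk
  · -- all terms vanish
    have : ∑ i ∈ range k, (if 3 ≤ i then ((if i.Prime then Real.log i else 0) - 1) else 0) = 0 :=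
      Finset.sum_eq_zero fun i hi => by rw [mem_range] at hi; rw [if_neg (by omega)]
    rw [this, abs_zero]; positivity
  -- `k ≥ 3`: split the sum
  have hsplit : ∑ i ∈ range k, (if 3 ≤ i then ((if i.Prime then Real.log i else 0) - 1) else 0) =
      (∑ i ∈ (range k).filter (fun i => 3 ≤ i), (if i.Prime then Real.log i else 0)) -
        ((range k).filter (fun i => 3 ≤ i)).card := by
    rw [← Finset.sum_filter, Finset.sum_sub_distrib, Finset.sum_const, nsmul_eq_mul, mul_one]
  have hcard : ((range k).filter (fun i => 3 ≤ i)).card = k - 3 := by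
    have : (range k).filter (fun i => 3 ≤ i) = Ico 3 k := by
      ext i; simp only [mem_filter, mem_range, mem_Ico]; omega
    rw [this, Nat.card_Ico]
  -- the prime sum is `θ(k-1) - log 2`
  have htheta : ∑ i ∈ (range k).filter (fun i => 3 ≤ i), (if i.Prime then Real.log i else 0) =
      Chebyshev.theta ((k - 1 : ℕ) : ℝ) - Real.log 2 := by
    rw [Chebyshev.theta_eq_sum_primesLE_log, ← Finset.sum_filter]
    have h2 : (2 : ℕ) ∈ Nat.primesLE (k - 1) := by
      rw [Nat.mem_primesLE]; exact ⟨by omega, Nat.prime_two⟩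
    rw [← Finset.add_sum_erase _ _ h2, Nat.cast_ofNat, add_sub_cancel_left]
    refine Finset.sum_congr ?_ fun _ _ => rfl
    ext p
    simp only [mem_filter, mem_range, Finset.mem_erase, Nat.mem_primesLE]
    constructor
    · rintro ⟨⟨hpk, h3⟩, hp⟩; exact ⟨by omega, by omega, hp⟩
    · rintro ⟨hp2, hpk, hp⟩
      have := hp.two_le
      exact ⟨⟨by omega, by omega⟩, hp⟩
  rw [hsplit, hcard, htheta, Nat.cast_sub hk]
  have hl2 : Real.log 2 < 0.6931471808 := Real.log_two_lt_d9
  have hl2' : 0 < Real.log 2 := Real.log_pos one_lt_two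
  have hk1 : ((k - 1 : ℕ) : ℝ) = k - 1 := by rw [Nat.cast_sub (by omega)]; simp
  rw [hk1]
  have : Chebyshev.theta ((k : ℝ) - 1) - Real.log 2 - ((k : ℝ) - (3 : ℕ)) =
      (Chebyshev.theta ((k : ℝ) - 1) - ((k : ℝ) - 1)) + (2 - Real.log 2) := by push_cast; ring
  rw [this]
  refine (abs_add_le _ _).trans (add_le_add le_rfl ?_)
  rw [abs_of_pos (by linarith)]
  linarith

/-- Eventually `3 log⁸ N ≤ √N`. [folklore] -/
theorem eventually_log_pow_eight_le_sqrt : ∀ᶠ N : ℕ in atTop, 3 * Real.log N ^ 8 ≤ Real.sqrt N := by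
  have h := (isLittleO_log_rpow_rpow_atTop (8 : ℝ) (by norm_num : (0 : ℝ) < 1 / 2)).bound
    (by norm_num : (0 : ℝ) < 1 / 3)
  filter_upwards [tendsto_natCast_atTop_atTop.eventually h, eventually_ge_atTop 1] with N hN hN1
  have hN1' : (1 : ℝ) ≤ N := by exact_mod_cast hN1
  have hlog : 0 ≤ Real.log N := Real.log_nonneg hN1'
  rw [Real.norm_of_nonneg (Real.rpow_nonneg hlog _),
    Real.norm_of_nonneg (Real.rpow_nonneg (by linarith) _), ← Real.sqrt_eq_rpow,
    show (8 : ℝ) = ((8 : ℕ) : ℝ) by norm_num, Real.rpow_natCast] at hN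
  linarith

/-- **PNT with error term, Chebyshev form along `ℕ`**: there is `C` with
`|θ(m) - m| ≤ C N/log⁷ N` for all `m ≤ N`, for all large `N`
(from `ψ(x) - x = O(x/log⁷ x)` and `|ψ - θ| ≤ 2√x log x`). [cite: MontgomeryVaughan2007, Theorem 6.9] -/
theorem eventually_abs_theta_sub_le :
    ∃ C : ℝ, 0 ≤ C ∧ ∀ᶠ N : ℕ in atTop, ∀ m : ℕ, m ≤ N →
      |Chebyshev.theta (m : ℝ) - m| ≤ C * N / Real.log N ^ 7 := by
  obtain ⟨C₀, hC₀pos, hC₀⟩ :=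
    (LFunctions.PsiLogPower.chebyshevPsi_sub_self_isBigO_div_logPow 7).exists_pos
  rw [Asymptotics.IsBigOWith, Filter.eventually_atTop] at hC₀
  obtain ⟨x₀, hx₀⟩ := hC₀
  refine ⟨2 ^ 7 * C₀ + 1, by positivity, ?_⟩
  filter_upwards [eventually_log_pow_eight_le_sqrt, eventually_ge_atTop ⌈x₀ ^ 2⌉₊,
    eventually_ge_atTop 16] with N hEN hNx hN16 m hm
  have hN0 : (0 : ℝ) < N := by exact_mod_cast (show 0 < N by omega)
  have hN16' : (16 : ℝ) ≤ N := by exact_mod_cast hN16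
  have hsqN : 4 ≤ Real.sqrt N := by
    rw [show (4 : ℝ) = Real.sqrt 16 by
      rw [show (16 : ℝ) = 4 ^ 2 by norm_num, Real.sqrt_sq (by norm_num)]]
    exact Real.sqrt_le_sqrt hN16'
  have hlogN : 1 ≤ Real.log N := by
    have he : Real.exp 1 ≤ N := by have := Real.exp_one_lt_d9; linarith
    have := Real.log_le_log (Real.exp_pos 1) he
    rwa [Real.log_exp] at this
  have hx₀N : x₀ ≤ Real.sqrt N := by
    have h1 : x₀ ^ 2 ≤ N := (Nat.le_ceil _).trans (by exact_mod_cast hNx)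
    calc x₀ ≤ |x₀| := le_abs_self _
      _ = Real.sqrt (x₀ ^ 2) := (Real.sqrt_sq_eq_abs _).symm
      _ ≤ Real.sqrt N := Real.sqrt_le_sqrt h1
  -- `3 √N log N ≤ N/log⁷ N`
  have hkey : 3 * Real.sqrt N * Real.log N ≤ N / Real.log N ^ 7 := by
    rw [le_div_iff₀ (by positivity)]
    calc 3 * Real.sqrt N * Real.log N * Real.log N ^ 7 = (3 * Real.log N ^ 8) * Real.sqrt N := by ring
      _ ≤ Real.sqrt N * Real.sqrt N := mul_le_mul_of_nonneg_right hEN (Real.sqrt_nonneg _)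
      _ = N := Real.mul_self_sqrt hN0.le
  have hmono : (N : ℝ) / Real.log N ^ 7 ≤ (2 ^ 7 * C₀ + 1) * N / Real.log N ^ 7 := by
    rw [mul_div_assoc]
    exact le_mul_of_one_le_left (by positivity) (by nlinarith)
  rcases le_or_gt (Real.sqrt N) m with hbig | hsmall
  · -- `m ≥ √N ≥ x₀`
    have hm0 : (0 : ℝ) < m := by linarith
    have hmN : (m : ℝ) ≤ N := by exact_mod_cast hm
    have hψ := hx₀ m (hx₀N.trans hbig)
    have hlogm1 : Real.log N / 2 ≤ Real.log m := by
      rw [← Real.log_sqrt hN0.le]; exact Real.log_le_log (by linarith) hbig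
    have hlogm0 : 0 < Real.log m := by linarith
    have h1 : |Chebyshev.psi m - m| ≤ 2 ^ 7 * C₀ * N / Real.log N ^ 7 := by
      rw [show (7 : ℝ) = ((7 : ℕ) : ℝ) by norm_num, Real.rpow_natCast, Real.norm_eq_abs,
        Real.norm_eq_abs, abs_of_nonneg (show (0 : ℝ) ≤ m / Real.log m ^ 7 by positivity)] at hψ
      refine hψ.trans ?_
      calc C₀ * ((m : ℝ) / Real.log m ^ 7) ≤ C₀ * (N / (Real.log N / 2) ^ 7) := by
            refine mul_le_mul_of_nonneg_left ?_ hC₀pos.le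
            exact div_le_div₀ hN0.le hmN (by positivity) (pow_le_pow_left₀ (by positivity) hlogm1 7)
        _ = 2 ^ 7 * C₀ * N / Real.log N ^ 7 := by field_simp
    have h2 : |Chebyshev.psi m - Chebyshev.theta m| ≤ N / Real.log N ^ 7 := by
      have h := Chebyshev.abs_psi_sub_theta_le_sqrt_mul_log (x := (m : ℝ)) (by linarith)
      refine h.trans (le_trans ?_ hkey)
      have hsm : Real.sqrt m ≤ Real.sqrt N := Real.sqrt_le_sqrt hmN
      have hlm : Real.log m ≤ Real.log N := Real.log_le_log hm0 hmN
      have h0 : 0 ≤ Real.sqrt m := Real.sqrt_nonneg _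
      calc 2 * Real.sqrt m * Real.log m ≤ 2 * Real.sqrt N * Real.log N :=
            mul_le_mul (mul_le_mul_of_nonneg_left hsm zero_le_two) hlm hlogm0.le (by positivity)
        _ ≤ 3 * Real.sqrt N * Real.log N := by nlinarith [Real.sqrt_nonneg (N : ℝ)]
    calc |Chebyshev.theta (m : ℝ) - m|
        = |(Chebyshev.psi m - m) - (Chebyshev.psi m - Chebyshev.theta m)| := by ring_nf
      _ ≤ |Chebyshev.psi m - m| + |Chebyshev.psi m - Chebyshev.theta m| := abs_sub _ _
      _ ≤ 2 ^ 7 * C₀ * N / Real.log N ^ 7 + N / Real.log N ^ 7 := add_le_add h1 h2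
      _ = (2 ^ 7 * C₀ + 1) * N / Real.log N ^ 7 := by ring
  · -- `m < √N`: trivial bounds
    have hm0 : (0 : ℝ) ≤ m := Nat.cast_nonneg m
    have hθ := Chebyshev.theta_le_log4_mul_x hm0
    have hθ0 := Chebyshev.theta_nonneg (m : ℝ)
    have hl4 : Real.log 4 < 2 := by
      have h4 : Real.log 4 = 2 * Real.log 2 := by
        rw [show (4 : ℝ) = 2 ^ 2 by norm_num, Real.log_pow]; norm_num
      have := Real.log_two_lt_d9; linarith
    calc |Chebyshev.theta (m : ℝ) - m| ≤ Chebyshev.theta m + m := abs_le.2 ⟨by linarith, by linarith⟩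
      _ ≤ 3 * Real.sqrt N := by nlinarith
      _ ≤ 3 * Real.sqrt N * Real.log N := le_mul_of_one_le_right (by positivity) hlogN
      _ ≤ N / Real.log N ^ 7 := hkey
      _ ≤ (2 ^ 7 * C₀ + 1) * N / Real.log N ^ 7 := hmono

/-- **The error of the model**: `E(N) = max_{k ≤ N+1} |∑_{i<k} c_i| ≤ C N/log⁷ N` for all large `N`,
where `c_i = 1_{prime}(i) - 1/log i` (`i ≥ 3`): i.e. `|π₂(x) - ∑_{3 ≤ n ≤ x} 1/log n| ≪ N/log⁷ N`
uniformly in `x ≤ N` (Abel summation from `θ(x) - x`). [cite: MontgomeryVaughan2007, Theorem 6.9] -/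
theorem eventually_abs_sum_primeCountErrCoeff_le :
    ∃ C : ℝ, 0 ≤ C ∧ ∀ᶠ N : ℕ in atTop, ∀ k : ℕ, k ≤ N + 1 →
      |∑ i ∈ range k, (if 3 ≤ i then ((if i.Prime then (1 : ℝ) else 0) - 1 / Real.log i) else 0)| ≤
        C * N / Real.log N ^ 7 := by
  obtain ⟨C, hC0, hC⟩ := eventually_abs_theta_sub_le
  have hl3 : 1 < Real.log 3 := by
    have he : Real.exp 1 < 3 := by have := Real.exp_one_lt_d9; linarith
    have := Real.log_lt_log (Real.exp_pos 1) he
    rwa [Real.log_exp] at this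
  refine ⟨C + 2, by positivity, ?_⟩
  filter_upwards [hC, eventually_log_pow_eight_le_sqrt, eventually_ge_atTop 16] with N hCN hEN hN16 k hk
  have hN0 : (0 : ℝ) < N := by exact_mod_cast (show 0 < N by omega)
  have hN16' : (16 : ℝ) ≤ N := by exact_mod_cast hN16
  have hlogN : 1 ≤ Real.log N := by
    have he : Real.exp 1 ≤ N := by have := Real.exp_one_lt_d9; linarith
    have := Real.log_le_log (Real.exp_pos 1) he
    rwa [Real.log_exp] at this
  -- `1 ≤ N/log⁷ N`
  have hone : 1 ≤ (N : ℝ) / Real.log N ^ 7 := by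
    rw [le_div_iff₀ (by positivity), one_mul]
    have hsq : Real.sqrt N ≤ N := by
      rw [Real.sqrt_le_left hN0.le]; nlinarith
    calc Real.log N ^ 7 ≤ Real.log N ^ 8 := pow_le_pow_right₀ hlogN (by norm_num)
      _ ≤ 3 * Real.log N ^ 8 := by linarith [pow_nonneg (zero_le_one.trans hlogN) 8]
      _ ≤ N := hEN.trans hsq
  rcases Nat.eq_zero_or_pos k with rfl | hkpos
  · simp only [Finset.range_zero, Finset.sum_empty, abs_zero]; positivity
  -- Abel summation with the antitone weights `1/log (max i 3)`
  set f : ℕ → ℝ := fun i => 1 / Real.log (max i 3 : ℕ) with hf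
  set u : ℕ → ℝ := fun i => if 3 ≤ i then ((if i.Prime then Real.log i else 0) - 1) else 0 with hu
  have hcu : ∀ i : ℕ, (if 3 ≤ i then ((if i.Prime then (1 : ℝ) else 0) - 1 / Real.log i) else 0) =
      f i • u i := by
    intro i
    simp only [hf, hu, smul_eq_mul]
    exact primeCountErrCoeff_eq i
  simp_rw [hcu]
  have hfval : ∀ i, 0 < f i ∧ f i ≤ 1 := by
    intro i
    have h3 : (3 : ℝ) ≤ (max i 3 : ℕ) := by exact_mod_cast le_max_right i 3
    have hl : 1 < Real.log (max i 3 : ℕ) := hl3.trans_le (Real.log_le_log (by norm_num) h3)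
    refine ⟨by rw [hf]; exact one_div_pos.2 (by linarith), ?_⟩
    rw [hf, div_le_one (by linarith)]; linarith
  have hfanti : ∀ i, f (i + 1) ≤ f i := by
    intro i
    simp only [hf]
    have h3 : (3 : ℝ) ≤ (max i 3 : ℕ) := by exact_mod_cast le_max_right i 3
    refine one_div_le_one_div_of_le (by linarith [hl3.trans_le (Real.log_le_log (by norm_num) h3)])
      (Real.log_le_log (by linarith) ?_)
    exact_mod_cast max_le_max (Nat.le_succ i) le_rfl
  have hU : ∀ j, j ≤ k → ‖∑ i ∈ range j, u i‖ ≤ C * N / Real.log N ^ 7 + 2 := by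
    intro j hj
    rw [Real.norm_eq_abs]
    refine (abs_sum_range_thetaCoeff_le j).trans (add_le_add ?_ le_rfl)
    exact hCN (j - 1) (by omega)
  have hAbel := norm_sum_range_smul_le_of_antitone (V := ℝ) hkpos (fun i _ => hfanti i)
    (hfval _).1.le hU
  rw [Real.norm_eq_abs] at hAbel
  refine hAbel.trans ?_
  have hf0 : f 0 ≤ 1 := (hfval 0).2
  have hX : 0 ≤ C * N / Real.log N ^ 7 + 2 := by positivity
  calc f 0 * (C * N / Real.log N ^ 7 + 2) ≤ 1 * (C * N / Real.log N ^ 7 + 2) :=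
        mul_le_mul_of_nonneg_right hf0 hX
    _ ≤ C * N / Real.log N ^ 7 + 2 * (N / Real.log N ^ 7) := by nlinarith
    _ = (C + 2) * N / Real.log N ^ 7 := by ring

/-! ### The model `T(β) = ∑_{3 ≤ n ≤ N} e(nβ)/log n`: size on `[0,1]` and decay away from `0` -/

/-- The weights `1/log(max(i,3))` decrease. [folklore] -/
theorem invLogMax_succ_le (i : ℕ) :
    1 / Real.log ((max (i + 1) 3 : ℕ) : ℝ) ≤ 1 / Real.log ((max i 3 : ℕ) : ℝ) := by
  have h3 : (3 : ℝ) ≤ (max i 3 : ℕ) := by exact_mod_cast le_max_right i 3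
  have hl3 : 0 < Real.log ((max i 3 : ℕ) : ℝ) := Real.log_pos (by linarith)
  refine one_div_le_one_div_of_le hl3 (Real.log_le_log (by linarith) ?_)
  exact_mod_cast max_le_max (Nat.le_succ i) le_rfl

/-- `0 < 1/log(max(i,3)) ≤ 1/log 3 < 1`. [folklore] -/
theorem invLogMax_pos_le (i : ℕ) :
    0 < 1 / Real.log ((max i 3 : ℕ) : ℝ) ∧ 1 / Real.log ((max i 3 : ℕ) : ℝ) ≤ 1 / Real.log 3 := by
  have h3 : (3 : ℝ) ≤ (max i 3 : ℕ) := by exact_mod_cast le_max_right i 3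
  have hl3 : 0 < Real.log (3 : ℝ) := Real.log_pos (by norm_num)
  exact ⟨one_div_pos.2 (hl3.trans_le (Real.log_le_log (by norm_num) h3)),
    one_div_le_one_div_of_le hl3 (Real.log_le_log (by norm_num) h3)⟩

/-- **Decay of the model**: `|T(β)| ≤ 1/(2 log 3 · ‖β‖)` for `‖β‖ ≠ 0` (Abel summation with the
decreasing weights `1/log n` and the geometric sum `|∑ e(nβ)| ≤ 1/(2‖β‖)`).
[cite: VaughanHL1997, §2 (Abel summation) and Lemma 2.? (geometric sum)] -/
theorem norm_logModel_le (N : ℕ) {β : ℝ} (hβ : 0 < distInt β) :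
    ‖∑ n ∈ Icc 3 N, (((1 / Real.log n : ℝ)) : ℂ) * (𝐞 ((n : ℝ) * β) : ℂ)‖ ≤
      1 / Real.log 3 * (1 / (2 * distInt β)) := by
  set f : ℕ → ℝ := fun i => 1 / Real.log ((max i 3 : ℕ) : ℝ) with hf
  set g : ℕ → ℂ := fun i => if 3 ≤ i then (𝐞 ((i : ℝ) * β) : ℂ) else 0 with hg
  -- the model as an Abel sum over `range (N+1)`
  have hT : ∑ n ∈ Icc 3 N, (((1 / Real.log n : ℝ)) : ℂ) * (𝐞 ((n : ℝ) * β) : ℂ) =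
      ∑ i ∈ range (N + 1), f i • g i := by
    have hIcc : Icc 3 N = (range (N + 1)).filter (fun i => 3 ≤ i) := by
      ext i; simp only [mem_Icc, mem_filter, mem_range]; omega
    rw [hIcc, Finset.sum_filter]
    refine Finset.sum_congr rfl fun i _ => ?_
    simp only [hf, hg]
    split_ifs with h3
    · rw [max_eq_left h3, Complex.real_smul]
    · rw [smul_zero]
  -- partial sums of `g` are geometric sums over `Ioc 2 (k-1)`
  have hG : ∀ k, k ≤ N + 1 → ‖∑ i ∈ range k, g i‖ ≤ 1 / (2 * distInt β) := by
    intro k _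
    have hset : ∑ i ∈ range k, g i = ∑ i ∈ Ioc 2 (k - 1), (𝐞 ((i : ℝ) * β) : ℂ) := by
      rw [hg, ← Finset.sum_filter]
      refine Finset.sum_congr ?_ fun _ _ => rfl
      ext i; simp only [mem_filter, mem_range, mem_Ioc]; omega
    rw [hset, le_div_iff₀ (by positivity)]
    have := norm_sum_Ioc_fourierChar_mul_distInt_le 2 (k - 1) β
    linarith
  rw [hT]
  have h := norm_sum_range_smul_le_of_antitone (V := ℂ) (f := f) (g := g) (Nat.succ_pos N)
    (fun i _ => invLogMax_succ_le i) (invLogMax_pos_le _).1.le hG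
  refine h.trans (mul_le_mul_of_nonneg_right ?_ (by positivity))
  simpa only [hf] using (invLogMax_pos_le 0).2

/-- On `[-1/2, 1/2]` the distance to the nearest integer is `|β|`. [folklore] -/
theorem distInt_eq_abs_of_abs_le_half {β : ℝ} (hβ : |β| ≤ 1 / 2) : distInt β = |β| := by
  unfold distInt
  rcases eq_or_lt_of_le hβ with h | h
  · -- `|β| = 1/2`
    rcases abs_eq (by norm_num : (0 : ℝ) ≤ 1 / 2) |>.1 h with h1 | h1
    · rw [h1]; norm_num [round_eq, Int.floor_eq_iff]
    · rw [h1]; norm_num [round_eq, Int.floor_eq_iff]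
  · have : round β = 0 := by
      rw [round_eq_zero_iff]; constructor <;> linarith [abs_lt.1 h |>.1, abs_lt.1 h |>.2]
    rw [this, Int.cast_zero, sub_zero]

/-- `∫_δ^{1/2} β⁻² dβ ≤ 1/δ` and the same on `[-1/2, -δ]`, for `0 < δ ≤ 1/2`. [folklore] -/
theorem integral_inv_sq_tail_le {δ : ℝ} (hδ : 0 < δ) (hδ2 : δ ≤ 1 / 2) :
    (∫ β in Set.Icc δ (1 / 2), (β ^ 2)⁻¹) ≤ 1 / δ ∧ (∫ β in Set.Icc (-(1 / 2)) (-δ), (β ^ 2)⁻¹) ≤ 1 / δ := by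
  have hderiv : ∀ x : ℝ, x ≠ 0 → HasDerivAt (fun y : ℝ => -y⁻¹) ((x ^ 2)⁻¹) x := by
    intro x hx
    have h := (hasDerivAt_inv hx).neg
    rw [neg_neg] at h
    exact h
  have hcont : ∀ a b : ℝ, 0 ∉ Set.uIcc a b → IntervalIntegrable (fun x : ℝ => (x ^ 2)⁻¹) volume a b := by
    intro a b h0
    refine ContinuousOn.intervalIntegrable (continuousOn_of_forall_continuousAt fun x hx => ?_)
    have hx : x ≠ 0 := fun h => h0 (h ▸ hx)
    exact (continuousAt_pow x 2).inv₀ (pow_ne_zero 2 hx)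
  constructor
  · have h0 : (0 : ℝ) ∉ Set.uIcc δ (1 / 2) := by
      rw [Set.uIcc_of_le hδ2]; intro h; exact absurd h.1 (not_le.2 hδ)
    rw [integral_Icc_eq_integral_Ioc, ← intervalIntegral.integral_of_le hδ2,
      intervalIntegral.integral_eq_sub_of_hasDerivAt (fun x hx => hderiv x ?_) (hcont _ _ h0)]
    · have : -(1 / 2 : ℝ)⁻¹ - -δ⁻¹ = 1 / δ - 2 := by ring
      rw [this]; linarith
    · intro hx0; exact h0 (hx0 ▸ hx)
  · have hle : -(1 / 2 : ℝ) ≤ -δ := by linarith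
    have h0 : (0 : ℝ) ∉ Set.uIcc (-(1 / 2)) (-δ) := by
      rw [Set.uIcc_of_le hle]; intro h; exact absurd h.2 (not_le.2 (by linarith))
    rw [integral_Icc_eq_integral_Ioc, ← intervalIntegral.integral_of_le hle,
      intervalIntegral.integral_eq_sub_of_hasDerivAt (fun x hx => hderiv x ?_) (hcont _ _ h0)]
    · have : -(-δ)⁻¹ - -(-(1 / 2 : ℝ))⁻¹ = 1 / δ - 2 := by ring
      rw [this]; linarith
    · intro hx0; exact h0 (hx0 ▸ hx)

/-- **The tail of the model**: for `0 < δ ≤ 1/2`,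
`∫_{[-1/2,1/2] ∖ [-δ,δ]} |T|² ≤ 1/(2 log² 3 · δ)`. [cite: VaughanHL1997, §3.1 (the model on the major arc)] -/
theorem setIntegral_tail_normSq_logModel_le (N : ℕ) {δ : ℝ} (hδ : 0 < δ) (hδ2 : δ ≤ 1 / 2) :
    ∫ β in Set.Icc (-(1 / 2 : ℝ)) (1 / 2) \ Set.Icc (-δ) δ,
        ‖∑ n ∈ Icc 3 N, (((1 / Real.log n : ℝ)) : ℂ) * (𝐞 ((n : ℝ) * β) : ℂ)‖ ^ 2 ≤
      1 / (2 * Real.log 3 ^ 2 * δ) := by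
  set T : ℝ → ℂ := fun β => ∑ n ∈ Icc 3 N, (((1 / Real.log n : ℝ)) : ℂ) * (𝐞 ((n : ℝ) * β) : ℂ)
    with hT
  set g : ℝ → ℝ := fun β => (1 / (4 * Real.log 3 ^ 2)) * (β ^ 2)⁻¹ with hg
  have hl3 : 0 < Real.log (3 : ℝ) := Real.log_pos (by norm_num)
  set D : Set ℝ := Set.Icc (-(1 / 2 : ℝ)) (1 / 2) \ Set.Icc (-δ) δ with hD
  set J₁ : Set ℝ := Set.Icc (-(1 / 2 : ℝ)) (-δ) with hJ₁
  set J₂ : Set ℝ := Set.Icc δ (1 / 2) with hJ₂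
  have hDsub : D ⊆ J₁ ∪ J₂ := by
    intro β hβ
    simp only [hD, Set.mem_sdiff, Set.mem_Icc, not_and_or, not_le] at hβ
    rcases hβ.2 with h | h
    · exact Or.inl ⟨hβ.1.1, h.le⟩
    · exact Or.inr ⟨h.le, hβ.1.2⟩
  -- pointwise bound on `D`
  have hpt : ∀ β ∈ J₁ ∪ J₂, ‖T β‖ ^ 2 ≤ g β := by
    intro β hβ
    have hβabs : δ ≤ |β| ∧ |β| ≤ 1 / 2 := by
      rcases hβ with h | h
      · simp only [hJ₁, Set.mem_Icc] at h
        rw [abs_of_neg (by linarith)]; constructor <;> linarith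
      · simp only [hJ₂, Set.mem_Icc] at h
        rw [abs_of_pos (by linarith)]; exact h
    have hβ0 : 0 < |β| := hδ.trans_le hβabs.1
    have hdist : distInt β = |β| := distInt_eq_abs_of_abs_le_half hβabs.2
    have h := norm_logModel_le N (β := β) (by rw [hdist]; exact hβ0)
    rw [hdist] at h
    have hTn : 0 ≤ ‖T β‖ := norm_nonneg _
    have hne : |β| ≠ 0 := hβ0.ne'
    calc ‖T β‖ ^ 2 ≤ (1 / Real.log 3 * (1 / (2 * |β|))) ^ 2 := pow_le_pow_left₀ hTn h 2
      _ = g β := by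
          simp only [hg]
          rw [show β ^ 2 = |β| ^ 2 from (sq_abs β).symm]
          field_simp
          ring
  -- integrability
  have hTcont : Continuous T := by
    simp only [hT]
    exact continuous_finsetSum _ fun n _ => continuous_const.mul
      (continuous_subtype_val.comp (Real.continuous_fourierChar.comp (continuous_const.mul continuous_id)))
  have hTint : ∀ s : Set ℝ, s ⊆ Set.Icc (-(1 / 2 : ℝ)) (1 / 2) → IntegrableOn (fun β => ‖T β‖ ^ 2) s :=
    fun s hs => ((continuous_norm.comp hTcont).pow 2).integrableOn_Icc.mono_set hs
  have hgint : ∀ a b : ℝ, 0 ∉ Set.Icc a b → IntegrableOn g (Set.Icc a b) := by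
    intro a b h0
    refine ContinuousOn.integrableOn_Icc (continuousOn_of_forall_continuousAt fun x hx => ?_)
    have hx : x ≠ 0 := fun h => h0 (h ▸ hx)
    exact ((continuousAt_pow x 2).inv₀ (pow_ne_zero 2 hx)).const_smul (1 / (4 * Real.log 3 ^ 2))
      |>.congr (by rfl)
  have h0J₁ : (0 : ℝ) ∉ J₁ := fun h => by simp only [hJ₁, Set.mem_Icc] at h; linarith
  have h0J₂ : (0 : ℝ) ∉ J₂ := fun h => by simp only [hJ₂, Set.mem_Icc] at h; linarith
  have hgJ : IntegrableOn g (J₁ ∪ J₂) := (hgint _ _ h0J₁).union (hgint _ _ h0J₂)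
  have hdisj : Disjoint J₁ J₂ := by
    rw [Set.disjoint_iff]; intro β ⟨h1, h2⟩
    simp only [hJ₁, hJ₂, Set.mem_Icc] at h1 h2; linarith
  -- the chain
  have hg0 : ∀ β, 0 ≤ g β := fun β => by simp only [hg]; positivity
  calc ∫ β in D, ‖T β‖ ^ 2 ≤ ∫ β in J₁ ∪ J₂, ‖T β‖ ^ 2 :=
        setIntegral_mono_set (hTint _ (Set.union_subset (fun β hβ => ⟨hβ.1, by
            simp only [hJ₁, Set.mem_Icc] at hβ; linarith⟩)
          (fun β hβ => ⟨by simp only [hJ₂, Set.mem_Icc] at hβ; linarith, hβ.2⟩)))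
          (Eventually.of_forall fun _ => sq_nonneg _) (Eventually.of_forall hDsub)
    _ ≤ ∫ β in J₁ ∪ J₂, g β :=
        setIntegral_mono_on (hTint _ (Set.union_subset (fun β hβ => ⟨hβ.1, by
            simp only [hJ₁, Set.mem_Icc] at hβ; linarith⟩)
          (fun β hβ => ⟨by simp only [hJ₂, Set.mem_Icc] at hβ; linarith, hβ.2⟩))) hgJ
          (measurableSet_Icc.union measurableSet_Icc) hpt
    _ = (∫ β in J₁, g β) + ∫ β in J₂, g β :=
        setIntegral_union hdisj measurableSet_Icc (hgint _ _ h0J₁) (hgint _ _ h0J₂)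
    _ ≤ (1 / (4 * Real.log 3 ^ 2)) * (1 / δ) + (1 / (4 * Real.log 3 ^ 2)) * (1 / δ) := by
        have hI := integral_inv_sq_tail_le hδ hδ2
        simp only [hg, hJ₁, hJ₂, integral_const_mul]
        exact add_le_add (mul_le_mul_of_nonneg_left hI.2 (by positivity))
          (mul_le_mul_of_nonneg_left hI.1 (by positivity))
    _ = 1 / (2 * Real.log 3 ^ 2 * δ) := by field_simp; ring

/-- **The size of the model**: `∫_{[-1/2,1/2]} |T|² = ∑_{3 ≤ n ≤ N} 1/log² n ≥ (N - 2)/log² N`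
(Parseval and `1`-periodicity). [cite: VaughanHL1997, §1.2 eq. (1.4)] -/
theorem le_setIntegral_normSq_logModel {N : ℕ} (hN : 3 ≤ N) :
    ((N : ℝ) - 2) / Real.log N ^ 2 ≤
      ∫ β in Set.Icc (-(1 / 2 : ℝ)) (1 / 2),
        ‖∑ n ∈ Icc 3 N, (((1 / Real.log n : ℝ)) : ℂ) * (𝐞 ((n : ℝ) * β) : ℂ)‖ ^ 2 := by
  set T : ℝ → ℂ := fun β => ∑ n ∈ Icc 3 N, (((1 / Real.log n : ℝ)) : ℂ) * (𝐞 ((n : ℝ) * β) : ℂ)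
    with hT
  have hTcont : Continuous T := by
    simp only [hT]
    exact continuous_finsetSum _ fun n _ => continuous_const.mul
      (continuous_subtype_val.comp (Real.continuous_fourierChar.comp (continuous_const.mul continuous_id)))
  have hF : Continuous fun β => ‖T β‖ ^ 2 := (continuous_norm.comp hTcont).pow 2
  -- periodicity
  have hper : ∀ β : ℝ, T (β - 1) = T β := by
    intro β
    simp only [hT]
    refine Finset.sum_congr rfl fun n _ => ?_
    congr 1
    rw [mul_sub, mul_one, sub_eq_add_neg, fourierChar_add_coe]
    have : (𝐞 (-(n : ℝ)) : ℂ) = 1 := by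
      have h : ((-(n : ℤ) : ℤ) : ℝ) = -(n : ℝ) := by push_cast; ring
      rw [← h, Real.fourierChar_apply', Circle.exp_two_pi_mul_int, Circle.coe_one]
    rw [this, mul_one]
  -- `∫_{-1/2}^{1/2} = ∫_0^1`
  have hshift : ∫ β in Set.Icc (-(1 / 2 : ℝ)) (1 / 2), ‖T β‖ ^ 2 = ∫ β in (0 : ℝ)..1, ‖T β‖ ^ 2 := by
    rw [integral_Icc_eq_integral_Ioc, ← intervalIntegral.integral_of_le (by norm_num),
      ← intervalIntegral.integral_add_adjacent_intervals (b := 0)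
        (hF.intervalIntegrable _ _) (hF.intervalIntegrable _ _),
      ← intervalIntegral.integral_add_adjacent_intervals (a := 0) (b := 1 / 2) (c := 1)
        (hF.intervalIntegrable _ _) (hF.intervalIntegrable _ _)]
    have h1 : ∫ β in (-(1 / 2 : ℝ))..0, ‖T β‖ ^ 2 = ∫ β in (1 / 2 : ℝ)..1, ‖T β‖ ^ 2 := by
      have := intervalIntegral.integral_comp_sub_right (fun β => ‖T β‖ ^ 2) (1 : ℝ)
        (a := 1 / 2) (b := 1)
      simp only [hper] at this
      rw [this]; norm_num
    rw [h1, add_comm]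
  rw [hshift, hT, integral_norm_sq_weightedExpSum]
  -- `∑_{3 ≤ n ≤ N} 1/log² n ≥ (N-2)/log² N`
  have hN3 : (3 : ℝ) ≤ N := by exact_mod_cast hN
  have hlogN : 0 < Real.log N := Real.log_pos (by linarith)
  calc ((N : ℝ) - 2) / Real.log N ^ 2 = ∑ _n ∈ Icc 3 N, (1 / Real.log N) ^ 2 := by
        rw [Finset.sum_const, Nat.card_Icc, nsmul_eq_mul, Nat.cast_sub (by omega)]
        push_cast
        field_simp
        ring
    _ ≤ ∑ n ∈ Icc 3 N, (1 / Real.log n) ^ 2 := by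
        refine Finset.sum_le_sum fun n hn => ?_
        rw [mem_Icc] at hn
        have hn3 : (3 : ℝ) ≤ n := by exact_mod_cast hn.1
        have hnN : (n : ℝ) ≤ N := by exact_mod_cast hn.2
        have hlogn : 0 < Real.log n := Real.log_pos (by linarith)
        exact pow_le_pow_left₀ (by positivity)
          (one_div_le_one_div_of_le hlogn (Real.log_le_log (by linarith) hnN)) 2

/-! ### `S - T` on the central arc -/

/-- `S(β) - T(β) = ∑_{i ≤ N} c_i e(iβ)` with `c_i = 1_{prime}(i) - 1/log i` (`i ≥ 3`), `0` (`i < 3`).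
[folklore] -/
theorem primeSum_sub_logModel_eq (N : ℕ) (β : ℝ) :
    primeSum N β - ∑ n ∈ Icc 3 N, (((1 / Real.log n : ℝ)) : ℂ) * (𝐞 ((n : ℝ) * β) : ℂ) =
      ∑ i ∈ range (N + 1),
        (((if 3 ≤ i then ((if i.Prime then (1 : ℝ) else 0) - 1 / Real.log i) else 0) : ℝ) : ℂ) *
          (𝐞 ((i : ℝ) * β) : ℂ) := by
  have hS : primeSum N β = ∑ i ∈ range (N + 1), if 3 ≤ i ∧ i.Prime then (𝐞 ((i : ℝ) * β) : ℂ) else 0 := by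
    rw [primeSum, oddPrimes, Finset.sum_filter]
    refine Finset.sum_congr rfl fun i _ => ?_
    have : (i.Prime ∧ Odd i) ↔ (3 ≤ i ∧ i.Prime) := by
      constructor
      · rintro ⟨hp, ho⟩
        refine ⟨?_, hp⟩
        have h2 := hp.two_le
        rcases eq_or_lt_of_le h2 with h | h
        · exact absurd (h ▸ ho) (by decide)
        · omega
      · rintro ⟨h3, hp⟩
        exact ⟨hp, hp.odd_of_ne_two (by omega)⟩
    simp only [this]
  have hT : ∑ n ∈ Icc 3 N, (((1 / Real.log n : ℝ)) : ℂ) * (𝐞 ((n : ℝ) * β) : ℂ) =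
      ∑ i ∈ range (N + 1), if 3 ≤ i then (((1 / Real.log i : ℝ)) : ℂ) * (𝐞 ((i : ℝ) * β) : ℂ) else 0 := by
    have hIcc : Icc 3 N = (range (N + 1)).filter (fun i => 3 ≤ i) := by
      ext i; simp only [mem_Icc, mem_filter, mem_range]; omega
    rw [hIcc, Finset.sum_filter]
  rw [hS, hT, ← Finset.sum_sub_distrib]
  refine Finset.sum_congr rfl fun i _ => ?_
  by_cases h3 : 3 ≤ i
  · by_cases hp : i.Prime
    · simp only [h3, hp, and_self, if_true]; push_cast; ring
    · simp only [h3, hp, and_false, if_false, if_true]; push_cast; ring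
  · simp only [h3, false_and, if_false]; push_cast; ring

/-! ### The central arc carries almost all of `∫ |S|² dβ` near `0`: `≥ (1-ε) N/log² N` -/

/-- `|a + b|² ≤ (1 + η)|a|² + (1 + 1/η)|b|²` (`η > 0`). [folklore] -/
theorem norm_add_sq_le_eta (a b : ℂ) {η : ℝ} (hη : 0 < η) :
    ‖a + b‖ ^ 2 ≤ (1 + η) * ‖a‖ ^ 2 + (1 + 1 / η) * ‖b‖ ^ 2 := by
  have h1 : ‖a + b‖ ≤ ‖a‖ + ‖b‖ := norm_add_le a b
  have h2 : ‖a + b‖ ^ 2 ≤ (‖a‖ + ‖b‖) ^ 2 := pow_le_pow_left₀ (norm_nonneg _) h1 2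
  have h3 : 2 * ‖a‖ * ‖b‖ ≤ η * ‖a‖ ^ 2 + (1 / η) * ‖b‖ ^ 2 := by
    have hsq : 0 ≤ (η * ‖a‖ - ‖b‖) ^ 2 := sq_nonneg _
    have hexp : (η * ‖a‖ - ‖b‖) ^ 2 = η * (η * ‖a‖ ^ 2 + (1 / η) * ‖b‖ ^ 2 - 2 * ‖a‖ * ‖b‖) := by
      field_simp; ring
    rw [hexp] at hsq
    have := (mul_nonneg_iff_of_pos_left hη).1 hsq
    linarith
  nlinarith

set_option maxHeartbeats 400000 in
/-- **The central arc**: for every `ε > 0` and all large `N`,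
`∫_{|β| ≤ (log N)³/N} |S(β)|² dβ ≥ (1 - ε) N/log² N`, where `S(β) = ∑_{p ≤ N, p odd} e(pβ)`.
(The `q = 1` term of `∫_𝔐 |S|² ∼ (N/log² N)∑_{q ≤ P} μ²(q)/φ(q)`, Pintz–Ruzsa I (8.20).)
[cite: PintzRuzsa2003, §8 (8.20)] [cite: VaughanHL1997, §3.1–§3.2 (major-arc model)] -/
theorem setIntegral_normSq_primeSum_central_ge :
    ∀ ε : ℝ, 0 < ε → ∀ᶠ N : ℕ in atTop,
      (1 - ε) * N / Real.log N ^ 2 ≤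
        ∫ β in Set.Icc (-(Real.log N ^ 3 / N)) (Real.log N ^ 3 / N), ‖primeSum N β‖ ^ 2 := by
  intro ε hε
  obtain ⟨C, hC0, hC⟩ := eventually_abs_sum_primeCountErrCoeff_le
  set η : ℝ := ε / 2 with hη
  have hη0 : 0 < η := by positivity
  have hl3 : 1 < Real.log 3 := by
    have he : Real.exp 1 < 3 := by have := Real.exp_one_lt_d9; linarith
    have := Real.log_lt_log (Real.exp_pos 1) he
    rwa [Real.log_exp] at this
  -- growth conditions
  have hlogN : Tendsto (fun N : ℕ => Real.log (N : ℝ)) atTop atTop :=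
    Real.tendsto_log_atTop.comp tendsto_natCast_atTop_atTop
  have hg1 : ∀ᶠ N : ℕ in atTop, (1 + 1 / η) * (392 * C ^ 2) ≤ (η / 2) * Real.log N ^ 3 := by
    have ht : Tendsto (fun N : ℕ => (η / 2) * Real.log (N : ℝ) ^ 3) atTop atTop :=
      (tendsto_pow_atTop (by norm_num : (3 : ℕ) ≠ 0) |>.comp hlogN).const_mul_atTop (by positivity)
    exact ht.eventually_ge_atTop _
  have hg2 : ∀ᶠ N : ℕ in atTop, 2 + (N : ℝ) / (2 * Real.log 3 ^ 2 * Real.log N) ≤ (η / 2) * N := by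
    -- `N / log N = o(N)` and `2 = o(N)`
    have h1 : ∀ᶠ N : ℕ in atTop, (N : ℝ) / (2 * Real.log 3 ^ 2 * Real.log N) ≤ (η / 4) * N := by
      filter_upwards [hlogN.eventually_ge_atTop (4 / (η * (2 * Real.log 3 ^ 2))),
        eventually_ge_atTop 3] with N hN hN3
      have hN0 : (0 : ℝ) < N := by exact_mod_cast (show 0 < N by omega)
      have hlog0 : 0 < Real.log N := Real.log_pos (by exact_mod_cast (show 1 < N by omega))
      rw [div_le_iff₀ (by positivity)]
      have : 4 ≤ η * (2 * Real.log 3 ^ 2) * Real.log N := by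
        rw [div_le_iff₀ (by positivity)] at hN; linarith
      nlinarith
    have h2 : ∀ᶠ N : ℕ in atTop, (2 : ℝ) ≤ (η / 4) * N :=
      (tendsto_natCast_atTop_atTop.const_mul_atTop (by positivity : (0 : ℝ) < η / 4)).eventually_ge_atTop 2
    filter_upwards [h1, h2] with N h1 h2
    linarith
  have hg3 : ∀ᶠ N : ℕ in atTop, Real.log (N : ℝ) ^ 3 / N ≤ 1 / 2 := by
    filter_upwards [eventually_log_pow_eight_le_sqrt, eventually_ge_atTop 16] with N hEN hN16
    have hN0 : (0 : ℝ) < N := by exact_mod_cast (show 0 < N by omega)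
    have hN16' : (16 : ℝ) ≤ N := by exact_mod_cast hN16
    have hlog1 : 1 ≤ Real.log N := by
      have he : Real.exp 1 ≤ N := by have := Real.exp_one_lt_d9; linarith
      have := Real.log_le_log (Real.exp_pos 1) he
      rwa [Real.log_exp] at this
    have hsq : Real.sqrt N ≤ N / 4 := by
      rw [le_div_iff₀ (by norm_num)]
      have h4 : 4 ≤ Real.sqrt N := by
        rw [show (4 : ℝ) = Real.sqrt 16 by
          rw [show (16 : ℝ) = 4 ^ 2 by norm_num, Real.sqrt_sq (by norm_num)]]
        exact Real.sqrt_le_sqrt hN16'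
      nlinarith [Real.mul_self_sqrt hN0.le, Real.sqrt_nonneg (N : ℝ)]
    rw [div_le_iff₀ hN0]
    have : Real.log N ^ 3 ≤ Real.log N ^ 8 := pow_le_pow_right₀ hlog1 (by norm_num)
    nlinarith [pow_nonneg (zero_le_one.trans hlog1) 8]
  filter_upwards [hC, hg1, hg2, hg3, eventually_ge_atTop 16] with N hCN hg1N hg2N hg3N hN16
  -- notation
  have hN0 : (0 : ℝ) < N := by exact_mod_cast (show 0 < N by omega)
  have hN16' : (16 : ℝ) ≤ N := by exact_mod_cast hN16
  have hlog1 : 1 ≤ Real.log N := by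
    have he : Real.exp 1 ≤ N := by have := Real.exp_one_lt_d9; linarith
    have := Real.log_le_log (Real.exp_pos 1) he
    rwa [Real.log_exp] at this
  have hlog0 : 0 < Real.log N := by linarith
  set δ : ℝ := Real.log N ^ 3 / N with hδ
  have hδ0 : 0 < δ := by positivity
  have hδ2 : δ ≤ 1 / 2 := hg3N
  set A : Set ℝ := Set.Icc (-δ) δ with hA
  set I : Set ℝ := Set.Icc (-(1 / 2 : ℝ)) (1 / 2) with hI
  have hAI : A ⊆ I := Set.Icc_subset_Icc (by linarith) hδ2
  set S : ℝ → ℂ := primeSum N with hS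
  set T : ℝ → ℂ := fun β => ∑ n ∈ Icc 3 N, (((1 / Real.log n : ℝ)) : ℂ) * (𝐞 ((n : ℝ) * β) : ℂ)
    with hT
  set D : ℝ → ℂ := fun β => S β - T β with hD
  set E : ℝ := C * N / Real.log N ^ 7 with hE
  have hE0 : 0 ≤ E := by positivity
  set M : ℝ := (N : ℝ) / Real.log N ^ 2 with hM
  have hM0 : 0 < M := by positivity
  -- continuity / integrability
  have hcontS : Continuous S := by
    simp only [hS]
    exact continuous_finsetSum _ fun p _ =>
      continuous_subtype_val.comp (Real.continuous_fourierChar.comp (continuous_const.mul continuous_id))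
  have hcontT : Continuous T := by
    simp only [hT]
    exact continuous_finsetSum _ fun n _ => continuous_const.mul
      (continuous_subtype_val.comp (Real.continuous_fourierChar.comp (continuous_const.mul continuous_id)))
  have hcontD : Continuous D := hcontS.sub hcontT
  have hint : ∀ (F : ℝ → ℂ), Continuous F → ∀ s : Set ℝ, s ⊆ I →
      IntegrableOn (fun β => ‖F β‖ ^ 2) s := fun F hF s hs =>
    ((continuous_norm.comp hF).pow 2).integrableOn_Icc.mono_set hs
  -- (1) pointwise: `|T|² ≤ (1+η)|S|² + (1+1/η)|D|²`
  have h1 : ∀ β, ‖T β‖ ^ 2 ≤ (1 + η) * ‖S β‖ ^ 2 + (1 + 1 / η) * ‖D β‖ ^ 2 := by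
    intro β
    have : T β = S β + (-(D β)) := by simp only [hD]; ring
    rw [this]
    have h := norm_add_sq_le_eta (S β) (-(D β)) hη0
    rwa [norm_neg] at h
  -- (2) integrate (1) over `A`
  have h2 : ∫ β in A, ‖T β‖ ^ 2 ≤
      (1 + η) * (∫ β in A, ‖S β‖ ^ 2) + (1 + 1 / η) * ∫ β in A, ‖D β‖ ^ 2 := by
    have hI2 : IntegrableOn (fun β => (1 + η) * ‖S β‖ ^ 2 + (1 + 1 / η) * ‖D β‖ ^ 2) A :=
      (((continuous_const.mul ((continuous_norm.comp hcontS).pow 2)).add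
        (continuous_const.mul ((continuous_norm.comp hcontD).pow 2))).integrableOn_Icc).mono_set hAI
    calc ∫ β in A, ‖T β‖ ^ 2 ≤ ∫ β in A, ((1 + η) * ‖S β‖ ^ 2 + (1 + 1 / η) * ‖D β‖ ^ 2) :=
          setIntegral_mono (hint T hcontT A hAI) hI2 h1
      _ = (1 + η) * (∫ β in A, ‖S β‖ ^ 2) + (1 + 1 / η) * ∫ β in A, ‖D β‖ ^ 2 := by
          rw [integral_add ((hint S hcontS A hAI).const_mul (1 + η))
              ((hint D hcontD A hAI).const_mul (1 + 1 / η)),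
            integral_const_mul, integral_const_mul]
  -- (3) `∫_A |D|² ≤ 2δ ((1 + 2πδ(N+1)) E)² ≤ 392 C² N/log⁵ N`
  have h3 : ∫ β in A, ‖D β‖ ^ 2 ≤ 392 * C ^ 2 * N / Real.log N ^ 5 := by
    have hptD : ∀ β ∈ A, ‖D β‖ ^ 2 ≤ ((1 + 2 * π * δ * (N + 1 : ℕ)) * E) ^ 2 := by
      intro β hβ
      have hβabs : |β| ≤ δ := abs_le.2 (by simpa [hA, Set.mem_Icc] using hβ)
      have hDsum : D β = ∑ i ∈ range (N + 1),
          (((if 3 ≤ i then ((if i.Prime then (1 : ℝ) else 0) - 1 / Real.log i) else 0) : ℝ) : ℂ) *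
            (𝐞 ((i : ℝ) * β) : ℂ) := primeSum_sub_logModel_eq N β
      have hb := norm_sum_range_fourierChar_mul_le (n := N + 1) β (fun k hk => hCN k hk)
      rw [← hDsum] at hb
      refine pow_le_pow_left₀ (norm_nonneg _) (hb.trans ?_) 2
      refine mul_le_mul_of_nonneg_right ?_ hE0
      have : 2 * π * |β| * (N + 1 : ℕ) ≤ 2 * π * δ * (N + 1 : ℕ) :=
        mul_le_mul_of_nonneg_right (mul_le_mul_of_nonneg_left hβabs (by positivity)) (by positivity)
      linarith
    have hvolA : (volume : Measure ℝ).real A = 2 * δ := by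
      rw [Measure.real, hA, Real.volume_Icc, ENNReal.toReal_ofReal (by linarith)]; ring
    calc ∫ β in A, ‖D β‖ ^ 2 ≤ ∫ _β in A, ((1 + 2 * π * δ * (N + 1 : ℕ)) * E) ^ 2 :=
          setIntegral_mono_on (hint D hcontD A hAI) (by
            simp only [hA]; exact (continuous_const).integrableOn_Icc) measurableSet_Icc hptD
      _ = 2 * δ * ((1 + 2 * π * δ * (N + 1 : ℕ)) * E) ^ 2 := by
          rw [setIntegral_const, hvolA, smul_eq_mul]
      _ ≤ 392 * C ^ 2 * N / Real.log N ^ 5 := by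
          -- `δ (N+1) ≤ 2 log³ N`, `1 + 4π log³ N ≤ 14 log³ N`
          have hδN : δ * (N + 1 : ℕ) ≤ 2 * Real.log N ^ 3 := by
            simp only [hδ]; push_cast
            rw [div_mul_eq_mul_div, div_le_iff₀ hN0]
            have : (N : ℝ) + 1 ≤ 2 * N := by linarith
            nlinarith [pow_nonneg hlog0.le 3]
          have hpi : π < 3.15 := Real.pi_lt_d2
          have hfac : 1 + 2 * π * δ * (N + 1 : ℕ) ≤ 14 * Real.log N ^ 3 := by
            have hl3' : 1 ≤ Real.log N ^ 3 := one_le_pow₀ hlog1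
            have : 2 * π * (δ * (N + 1 : ℕ)) ≤ 2 * π * (2 * Real.log N ^ 3) :=
              mul_le_mul_of_nonneg_left hδN (by positivity)
            nlinarith [Real.pi_pos]
          have hfac0 : 0 ≤ 1 + 2 * π * δ * (N + 1 : ℕ) := by positivity
          calc 2 * δ * ((1 + 2 * π * δ * (N + 1 : ℕ)) * E) ^ 2
              = 2 * δ * (1 + 2 * π * δ * (N + 1 : ℕ)) ^ 2 * E ^ 2 := by ring
            _ ≤ 2 * δ * (14 * Real.log N ^ 3) ^ 2 * E ^ 2 := by
                have := pow_le_pow_left₀ hfac0 hfac 2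
                have hE2 : 0 ≤ E ^ 2 := sq_nonneg _
                nlinarith [mul_nonneg (mul_nonneg (by positivity : (0:ℝ) ≤ 2 * δ) (sub_nonneg.2 this)) hE2]
            _ = 392 * C ^ 2 * N / Real.log N ^ 5 := by
                simp only [hδ, hE]; field_simp; ring
  -- (4) `∫_A |T|² ≥ (N-2)/log² N - N/(2 log² 3 · log³ N)`
  have h4 : ((N : ℝ) - 2) / Real.log N ^ 2 - (N : ℝ) / (2 * Real.log 3 ^ 2 * Real.log N ^ 3) ≤
      ∫ β in A, ‖T β‖ ^ 2 := by
    have hIeq : ∫ β in A, ‖T β‖ ^ 2 = (∫ β in I, ‖T β‖ ^ 2) - ∫ β in I \ A, ‖T β‖ ^ 2 := by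
      rw [setIntegral_sdiff measurableSet_Icc (hint T hcontT I subset_rfl) hAI]; ring
    have hfull := le_setIntegral_normSq_logModel (N := N) (by omega)
    have htail := setIntegral_tail_normSq_logModel_le N hδ0 hδ2
    have : 1 / (2 * Real.log 3 ^ 2 * δ) = (N : ℝ) / (2 * Real.log 3 ^ 2 * Real.log N ^ 3) := by
      simp only [hδ]; field_simp
    rw [this] at htail
    rw [hIeq]
    linarith
  -- (5) combine
  have hTlow : (1 - η / 2) * M ≤ ∫ β in A, ‖T β‖ ^ 2 := by
    refine le_trans ?_ h4
    -- `2/log² N + N/(2 log²3 log³N) ≤ (η/2) M`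
    have : 2 / Real.log N ^ 2 + (N : ℝ) / (2 * Real.log 3 ^ 2 * Real.log N ^ 3) ≤ (η / 2) * M := by
      simp only [hM]
      rw [show 2 / Real.log N ^ 2 + (N : ℝ) / (2 * Real.log 3 ^ 2 * Real.log N ^ 3) =
        (2 + (N : ℝ) / (2 * Real.log 3 ^ 2 * Real.log N)) / Real.log N ^ 2 by field_simp,
        show η / 2 * ((N : ℝ) / Real.log N ^ 2) = (η / 2 * N) / Real.log N ^ 2 by ring]
      exact div_le_div_of_nonneg_right hg2N (by positivity)
    have hsplit : ((N : ℝ) - 2) / Real.log N ^ 2 = M - 2 / Real.log N ^ 2 := by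
      simp only [hM]; field_simp
    rw [hsplit]
    linarith
  have hDup : (1 + 1 / η) * ∫ β in A, ‖D β‖ ^ 2 ≤ (η / 2) * M := by
    calc (1 + 1 / η) * ∫ β in A, ‖D β‖ ^ 2 ≤ (1 + 1 / η) * (392 * C ^ 2 * N / Real.log N ^ 5) :=
          mul_le_mul_of_nonneg_left h3 (by positivity)
      _ = ((1 + 1 / η) * (392 * C ^ 2)) / Real.log N ^ 3 * M := by simp only [hM]; field_simp
      _ ≤ ((η / 2) * Real.log N ^ 3) / Real.log N ^ 3 * M :=
          mul_le_mul_of_nonneg_right (div_le_div_of_nonneg_right hg1N (by positivity)) hM0.le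
      _ = (η / 2) * M := by field_simp
  -- from (2): `(1+η) ∫_A |S|² ≥ ∫_A|T|² - (1+1/η)∫_A|D|² ≥ (1 - η) M`
  have hS1 : (1 - η) * M ≤ (1 + η) * ∫ β in A, ‖S β‖ ^ 2 := by linarith
  have hfin : (1 - ε) * M ≤ ∫ β in A, ‖S β‖ ^ 2 := by
    have hε2 : (1 - ε) * (1 + η) ≤ 1 - η := by
      rw [hη, show (1 - ε) * (1 + ε / 2) = (1 - ε / 2) - ε ^ 2 / 2 by ring]
      linarith [sq_nonneg ε]
    have h := mul_le_mul_of_nonneg_right hε2 hM0.le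
    have h3 : (1 + η) * ((1 - ε) * M) ≤ (1 + η) * ∫ β in A, ‖S β‖ ^ 2 :=
      calc (1 + η) * ((1 - ε) * M) = (1 - ε) * (1 + η) * M := by ring
        _ ≤ (1 - η) * M := h
        _ ≤ (1 + η) * ∫ β in A, ‖S β‖ ^ 2 := hS1
    exact le_of_mul_le_mul_left h3 (by positivity)
  simpa only [hM, mul_div_assoc] using hfin

end GoldbachLinnik

end Literature.NumberTheory.Sieve
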